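/-
Copyright (c) 2026 the pub-hodgecm-mathlib formalisation cell (harness21).  R90-TF SLAB, section S10 (Rogawski 1990, §13.8 read at `v`),
prover R90-C138-p08 (g2) — RULING J-LC′-2 (R90-C138-plan (g3) 2026-09-05T03:00:41Z): the H1-LAYER BRIDGE of the named residual letter L-C′;
h413 = `stmt-HodgeConjecture-24833`, route `HCCMUnconditional`.
-/
import Summits.HodgeConjecture.HodgeConjecture.Theorems.R90S10TorusCharExtendLetterDefs   -- ★ p864883 (p06): the TORUS-LAYER letter `TorusCharExtendLetter L v` (sub-socket `sock_S10_torusCharExtend`)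
import Summits.HodgeConjecture.HodgeConjecture.Theorems.R90S10TorusCharExtendHolds        -- ★ p864932 (K2E5-p16): `torusCharExtendLetter_holds L v` — the torus layer PAID
import Summits.HodgeConjecture.HodgeConjecture.Theorems.R90S10ThetaLineOfXi               -- ★ p864606: `R90.S5.chiOneOfOneDim`, carriers `H1`∕`H1Loc`, `chiOneOfOneDim_eq_torusLocalComponent_comp_localDet`
import Literature.NumberTheory.Automorphic.UnitaryGroupDetCharacter                          -- ★ `cmDetChar`, `cmDetChar_inclPlaceAdelic`
import Literature.NumberTheory.Automorphic.CharacterLineFinConstituents                      -- ★ `UnitaryGroup.isOpen_ker_comp_inclPlaceAdelic`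
import Literature.NumberTheory.Automorphic.LocalUnitaryIntegralLevel                         -- ★ `cmLocalIntegralLevel`, `mem_localIntegralLevel_iff`
import HarnessLib

/-!
# R90-TF ∕ S10 — THE H1-LAYER BRIDGE OF L-C′: from the torus letter ★ `TorusCharExtendLetter L v` to the θ-LINE BINDERS of block C
# (`Theorems/R90S10ThetaCharOfTorusCharExtend.lean`; ns `Summit.HodgeConjecture.HodgeConjecture.R90.S10`; theorems only — no `def`, no instance, no notation, no `sorry`)

Print: [Rogawski1990] §13.8 p. 217 l. 9–12 («every character of `Π′𝒪_v^1` extends to a character of `E^1\E^1_𝔸`»), p. 218 L9–10 («`ρ = ρ′ ⊠ θ` … `θ_v = χ`»), p. 219 L1–2;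
§13.3 pp. 202–203 (`ξ = (η, ψ)`, `ξ_v ∘ inr = ψ_v ∘ det`); §12.2 pp. 173–174 (local components of `ψ ∘ det`).

## RULING J-LC′-2 (three hands, two layers, ONE def)
TORUS LAYER = ★ p864883 `TorusCharExtendLetter L v` (p06; payer K2E5-p16 `torusCharExtendLetter_holds`; A ED. 10 sub-socket `sock_S10_torusCharExtend`).  H1 LAYER = THIS FILE:
`exists_thetaChar_of_torusCharExtendLetter (h : TorusCharExtendLetter L v) (ξ) (hns) : ∃ Θ θloc, (∀ w, IsOpen (θloc w).ker) ∧ ‹R4′ hΘ› ∧ θloc v = chiOneOfOneDim ξ v ∧ ‹hχθK›`, i.e. the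
torus letter, applied at the `v`-component `χ_T := ψ_v` of `ξ`'s `det`-character (★ `torusLocalComponent L c v ξ.ψ`, continuous by ★ `continuous_torusLocalComponent`), yields an
automorphic `ψ'` of `T(𝔸_{L⁺})` with `ψ'_v = ψ_v`, spherical off `v`; then `Θ := ψ' ∘ det` (★ `cmDetChar L 1 Φ₁ ψ'`) and `θloc w := ψ'_w ∘ det` are block C's abstract θ-line with its two pins:
* `hΘ` (R4′ compatibility, bytes of ★ `thetaLine_of_char` 42935abc) IS ★ `cmDetChar_inclPlaceAdelic` [§12.2 pp. 173–174];
* `hθo`: a continuous character of `U(Φ₁)(𝔸_f)` is smooth (★ `UnitaryGroup.isOpen_ker_comp_inclPlaceAdelic`), pulled through the homeomorphism ★ `localPiEquiv`;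
* `hθv`: `ψ'_v = ψ_v` + ★ `chiOneOfOneDim_eq_torusLocalComponent_comp_localDet` («`ξ_v ∘ inr = ψ_v ∘ det`», §13.3 p. 202);
* `hθunr` (= p06's `hχθK` bytes: `θloc w` trivial on ★ `cmLocalIntegralLevel L 1 Φ₁ w`, `w ≠ v`): `det` of an element of `U(Φ₁)(𝒪_w)` is a unit above `w` (§1
  `coe_locTorusIncl_localDet_mem_localUnitIdeles`, EVERY finite `w` — split, inert or ramified), so `locTorusIncl w (det k)` lies in the local unit ideles ★ `IdeleHerbrand.localUnitIdeles L⁺ L w`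
  where `ψ'` is spherical.  The letter's archimedean-type conjunct is not needed here (it serves p05's (C-ii)).
Consumer (p05's (C-iii-3) ∕ A's C-payer): `obtain ⟨Θ, θloc, hθo, hΘ, hθv, hθunr⟩ := exists_thetaChar_of_torusCharExtendLetter h ξ hns`; and since the torus layer IS
★ (`torusCharExtendLetter_holds`, K2E5-p16 p864932), §3 `exists_thetaChar_of_nonsplit ξ hns` delivers the θ-line binders UNCONDITIONALLY at every non-split `v` — the named
residual L-C′ of ruling J-θ is thereby DISCHARGED in the H1 layer.
HONEST LABEL: a bridge + its unconditional corollary; block C's OTHER inputs (p05's (C-ii)(C-iii) assembly, the realisation letters L-A∕L-B∕L-E∕L-F) are untouched; HC_CM is proved only modulo the 7 printed citations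
(2 remaining named inputs: hLiu418 = `stmt-HodgeConjecture-24832`, h413 = `stmt-HodgeConjecture-24833`) until rung 0 closes; REL ≠ ★ ≠ BUILT.
-/

set_option autoImplicit false
set_option linter.dupNamespace false

noncomputable section

open NumberField IsDedekindDomain
open scoped Matrix Valued ValuativeRel
open Literature.NumberTheory Literature.NumberTheory.Automorphic Literature.NumberTheory.Automorphic.UnitaryGroup
open Literature.NumberTheory.Rogawski1990 Literature.NumberTheory.GaloisRepresentations
open Literature.NumberTheory.Automorphic.Arthur2013.Leaves.TECR
open Summit.HodgeConjecture.HodgeConjecture.Cruxes.H413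
open Summit.HodgeConjecture.HodgeConjecture.Cruxes.H413.K2E1TraceFormulaBeta (Pl)
open Summit.HodgeConjecture.HodgeConjecture.Cruxes.H413.K2E1SpectralTermsDiscreteHalf

namespace Summit.HodgeConjecture.HodgeConjecture.R90.S10

variable {L : Type} [Field L] [NumberField L] [IsCMField L]

/-! ## §1 `det` of the integral level is a local unit: `locTorusIncl w (det k) ∈ localUnitIdeles L⁺ L w` -/

/-- **An element of `GL_1(𝒪_{w'})` has unit determinant**: if the `w'`-component of `g ∈ GL_1(∏_{w'∣w} L_{w'})` lies in `GL_1(𝒪_{w'})` (★ `glInt`: entries of it and of its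
inverse integral), then `v_{w'}(det g) = 1` — the `(0,0)`-entries of the component and of its inverse are integral with product `1`. [cite: PlatonovRapinchuk1994, §5.1] -/
theorem valuation_det_apply_eq_one_of_mem_glInt (w : Pl L) (g : GL (Fin 1) (LocalRing L w)) (q : PlacesOver L w)
    (hg : localGLPiEquiv L 1 w g q ∈ glInt 1 (q.1.adicCompletion L)) :
    Valued.v (((g : GL (Fin 1) (LocalRing L w)) : Matrix (Fin 1) (Fin 1) (LocalRing L w)).det q) = 1 := by
  obtain ⟨h1, h2⟩ := (mem_glInt_iff _).1 hg
  set G : GL (Fin 1) (q.1.adicCompletion L) := localGLPiEquiv L 1 w g q with hG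
  have hdet : ((g : GL (Fin 1) (LocalRing L w)) : Matrix (Fin 1) (Fin 1) (LocalRing L w)).det q =
      (G : Matrix (Fin 1) (Fin 1) (q.1.adicCompletion L)) 0 0 := by
    rw [Matrix.det_fin_one, hG, GLn.coe_piEquiv_apply, Matrix.map_apply]
    rfl
  rw [hdet]
  -- in the `ValuativeRel` currency of ★ `glInt`: the entry and the inverse's entry are integral with product `1`
  have ha : ValuativeRel.valuation _ ((G : Matrix (Fin 1) (Fin 1) (q.1.adicCompletion L)) 0 0) ≤ 1 := (Valuation.mem_integer_iff _ _).1 (h1 0 0)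
  have hb : ValuativeRel.valuation _ (((G⁻¹ : GL (Fin 1) (q.1.adicCompletion L)) : Matrix (Fin 1) (Fin 1) (q.1.adicCompletion L)) 0 0) ≤ 1 :=
    (Valuation.mem_integer_iff _ _).1 (h2 0 0)
  have hprod : (G : Matrix (Fin 1) (Fin 1) (q.1.adicCompletion L)) 0 0 *
      ((G⁻¹ : GL (Fin 1) (q.1.adicCompletion L)) : Matrix (Fin 1) (Fin 1) (q.1.adicCompletion L)) 0 0 = 1 := by
    have hmul : ((G : Matrix (Fin 1) (Fin 1) (q.1.adicCompletion L)) *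
        ((G⁻¹ : GL (Fin 1) (q.1.adicCompletion L)) : Matrix (Fin 1) (Fin 1) (q.1.adicCompletion L))) 0 0 = 1 := by
      rw [← Units.val_mul, mul_inv_cancel, Units.val_one, Matrix.one_apply_eq]
    rw [Matrix.mul_apply, Fin.sum_univ_one] at hmul
    exact hmul
  have hv : ValuativeRel.valuation _ ((G : Matrix (Fin 1) (Fin 1) (q.1.adicCompletion L)) 0 0) *
      ValuativeRel.valuation _ (((G⁻¹ : GL (Fin 1) (q.1.adicCompletion L)) : Matrix (Fin 1) (Fin 1) (q.1.adicCompletion L)) 0 0) = 1 := by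
    rw [← map_mul, hprod, map_one]
  have hone : ValuativeRel.valuation _ ((G : Matrix (Fin 1) (Fin 1) (q.1.adicCompletion L)) 0 0) = 1 :=
    le_antisymm ha (by
      calc (1 : _) = _ * _ := hv.symm
        _ ≤ _ := mul_le_of_le_one_right' hb)
  -- transport to the `Valued.v` currency of ★ `localUnitIdeles` (compatible valuations induce the same order)
  have hle : ∀ a b : q.1.adicCompletion L,
      ValuativeRel.valuation _ a ≤ ValuativeRel.valuation _ b ↔ Valued.v a ≤ Valued.v b := fun a b =>
    (Valuation.Compatible.vle_iff_le (v := ValuativeRel.valuation (q.1.adicCompletion L)) a b).symm.trans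
      (Valuation.Compatible.vle_iff_le (v := (Valued.v : Valuation (q.1.adicCompletion L) (WithZero (Multiplicative ℤ)))) a b)
  refine le_antisymm ?_ ?_
  · have h := (hle ((G : Matrix (Fin 1) (Fin 1) (q.1.adicCompletion L)) 0 0) 1).1 (by rw [hone, map_one])
    rwa [map_one] at h
  · have h := (hle 1 ((G : Matrix (Fin 1) (Fin 1) (q.1.adicCompletion L)) 0 0)).1 (by rw [hone, map_one])
    rwa [map_one] at h

/-- **`det U(Φ₁)(𝒪_w) ⊆ T(𝒪_w)`**: for `k` in the integral level `U(Φ₁)(𝒪_w) ≤ U(Φ₁)(L⁺_w)` (★ `cmLocalIntegralLevel L 1 Φ₁ w`, «`k_{w'} ∈ GL_1(𝒪_{w'})` at every `w' ∣ w`»,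
★ `mem_localIntegralLevel_iff`), the idele `locTorusIncl w (det k)` (component `det k_{w'}` at `w' ∣ w`, `1` elsewhere — ★ `coe_locTorusIncl`, ★ `semilocalUnits_*`) lies in the
local unit ideles ★ `IdeleHerbrand.localUnitIdeles L⁺ L w` (`valuation_det_apply_eq_one_of_mem_glInt` above `w`).  Valid at every finite `w` (split, inert or ramified).
[cite: PlatonovRapinchuk1994, §5.1] [cite: Rogawski1990, §12.2 pp. 173–174] -/
theorem coe_locTorusIncl_localDet_mem_localUnitIdeles (w : Pl L)
    (k : ↥(«local» L (IsCMField.complexConj L) 1 (Matrix.of fun i j : Fin 1 => if i.val + j.val + 1 = 1 then (1 : L) else 0) w))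
    (hk : k ∈ localIntegralLevel (IsCMField.complexConj L) 1 (Matrix.of fun i j : Fin 1 => if i.val + j.val + 1 = 1 then (1 : L) else 0) w) :
    ((locTorusIncl L (IsCMField.complexConj L) w (localDet (IsCMField.complexConj L) w (isUnit_antidiagOne_det L 1) k) :
        ↥(TorusDict.torus (IsCMField.complexConj L))) : GaloisRepresentations.ideleGroup L) ∈
      IdeleHerbrand.localUnitIdeles (↥(maximalRealSubfield L)) L w := by
  rw [coe_locTorusIncl, IdeleHerbrand.mem_localUnitIdeles_iff]
  refine ⟨semilocalUnits_fst L _, fun q hq => semilocalUnits_snd_apply_of_not_over L _ hq, fun q => ?_⟩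
  by_cases hq : q.under (𝓞 ↥(maximalRealSubfield L)) = w
  · rw [semilocalUnits_snd_apply_of_over L _ ⟨q, hq⟩, coe_coe_localDet]
    exact valuation_det_apply_eq_one_of_mem_glInt w _ ⟨q, hq⟩
      ((mem_localIntegralLevel_iff (IsCMField.complexConj L) 1 _ w k).1 hk ⟨q, hq⟩)
  · rw [semilocalUnits_snd_apply_of_not_over L _ hq, map_one]

/-! ## §2 The bridge: torus letter ⟹ the θ-line binders `Θ θloc hθo hΘ` with pins `hθv`, `hθunr` -/

/-- **THE H1-LAYER BRIDGE OF L-C′.**  From the torus letter ★ `TorusCharExtendLetter L v` (p06, p864883) at a place `v` not split in `L` (`hns`, the A :908 bytes): apply it to the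
continuous character `χ_T := ψ_v` of `T(L⁺_v)` (★ `torusLocalComponent L c v ξ.ψ`, ★ `continuous_torusLocalComponent`) to get an automorphic `ψ'` with `ψ'_v = ψ_v`, spherical at every
finite `w ≠ v`; then `Θ := ψ' ∘ det` (★ `cmDetChar L 1 Φ₁ ψ'`) with local readings `θloc w := ψ'_w ∘ det` is an automorphic character of `U(Φ₁)(𝔸_{L⁺})` with open-kernel local readings
(★ `isOpen_ker_comp_inclPlaceAdelic` through ★ `localPiEquiv`), R4′-compatible (★ `cmDetChar_inclPlaceAdelic`), pinned at `v` to ★ `R90.S5.chiOneOfOneDim ξ v` (★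
`chiOneOfOneDim_eq_torusLocalComponent_comp_localDet`) and trivial on ★ `cmLocalIntegralLevel L 1 Φ₁ w` for every finite `w ≠ v` (§1).  Consumer: `obtain ⟨Θ, θloc, hθo, hΘ, hθv, hθunr⟩`.
[cite: Rogawski1990, §13.8 p. 217 l. 9–12, p. 218 L9–10, p. 219 L1–2; §13.3 pp. 202–203; §12.2 pp. 173–174] [cite: Weil1956, §1] -/
theorem exists_thetaChar_of_torusCharExtendLetter {v : Pl L} (h : TorusCharExtendLetter L v) (ξ : OneDimAutRepH L)
    (hns : ∀ w : PlacesOver L v, IsCMField.complexConj L • w.1 = w.1) :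
    ∃ (Θ : (H1 L).AutomorphicCharacter) (θloc : ∀ w : Pl L, H1Loc L w →* ℂˣ),
      (∀ w : Pl L, IsOpen ((((θloc w).ker : Subgroup (H1Loc L w))) : Set (H1Loc L w))) ∧
      (∀ (w : Pl L) (u : localPi L (IsCMField.complexConj L) 1 (Matrix.of fun i j : Fin 1 => if i.val + j.val + 1 = 1 then (1 : L) else 0) w),
        θloc w (localPiEquiv L (IsCMField.complexConj L) 1 (Matrix.of fun i j : Fin 1 => if i.val + j.val + 1 = 1 then (1 : L) else 0) w u) =
          Θ (inclPlaceAdelic (↥(maximalRealSubfield L)) L (IsCMField.complexConj L) 1 (Matrix.of fun i j : Fin 1 => if i.val + j.val + 1 = 1 then (1 : L) else 0) w u)) ∧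
      θloc v = R90.S5.chiOneOfOneDim ξ v ∧
      ∀ w : Pl L, w ≠ v → ∀ k ∈ cmLocalIntegralLevel L 1 (Matrix.of fun i j : Fin 1 => if i.val + j.val + 1 = 1 then (1 : L) else 0) w, θloc w k = 1 := by
  obtain ⟨ψ', hψ', -, hv, hsph, -⟩ := h hns (torusLocalComponent L (IsCMField.complexConj L) v ξ.ψ)
    (continuous_torusLocalComponent L (IsCMField.complexConj L) ξ.ψ)
  have hdet : (Matrix.of fun i j : Fin 1 => if i.val + j.val + 1 = 1 then (1 : L) else 0).det ≠ 0 := (isUnit_antidiagOne_det L 1).ne_zero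
  refine ⟨cmDetChar L 1 _ ψ' hψ' hdet,
    fun w => (torusLocalComponent L (IsCMField.complexConj L) w ψ').comp (localDet (IsCMField.complexConj L) w (isUnit_antidiagOne_det L 1)),
    fun w => ?_, fun w u => ?_, ?_, fun w hw k hk => ?_⟩
  · -- open kernel: the kernel is the `localPiEquiv.symm`-preimage of the (open) kernel of `Θ ∘ inclPlaceAdelic w`
    have hopen := UnitaryGroup.isOpen_ker_comp_inclPlaceAdelic (cmDetChar L 1 _ ψ' hψ' hdet).toMonoidHom (cmDetChar L 1 _ ψ' hψ' hdet).continuous w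
    change IsOpen ((((torusLocalComponent L (IsCMField.complexConj L) w ψ').comp
          (localDet (IsCMField.complexConj L) w (isUnit_antidiagOne_det L 1))).ker :
          Subgroup ↥(«local» L (IsCMField.complexConj L) 1 (Matrix.of fun i j : Fin 1 => if i.val + j.val + 1 = 1 then (1 : L) else 0) w)) :
        Set ↥(«local» L (IsCMField.complexConj L) 1 (Matrix.of fun i j : Fin 1 => if i.val + j.val + 1 = 1 then (1 : L) else 0) w))
    have hset : ((((torusLocalComponent L (IsCMField.complexConj L) w ψ').comp
          (localDet (IsCMField.complexConj L) w (isUnit_antidiagOne_det L 1))).ker :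
          Subgroup ↥(«local» L (IsCMField.complexConj L) 1 (Matrix.of fun i j : Fin 1 => if i.val + j.val + 1 = 1 then (1 : L) else 0) w)) :
        Set ↥(«local» L (IsCMField.complexConj L) 1 (Matrix.of fun i j : Fin 1 => if i.val + j.val + 1 = 1 then (1 : L) else 0) w)) =
        (localPiEquiv L (IsCMField.complexConj L) 1 (Matrix.of fun i j : Fin 1 => if i.val + j.val + 1 = 1 then (1 : L) else 0) w).symm ⁻¹'
          ((((cmDetChar L 1 _ ψ' hψ' hdet).toMonoidHom.comp
              (inclPlaceAdelic (↥(maximalRealSubfield L)) L (IsCMField.complexConj L) 1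
                (Matrix.of fun i j : Fin 1 => if i.val + j.val + 1 = 1 then (1 : L) else 0) w)).ker :
              Subgroup (localPi L (IsCMField.complexConj L) 1 (Matrix.of fun i j : Fin 1 => if i.val + j.val + 1 = 1 then (1 : L) else 0) w)) :
            Set (localPi L (IsCMField.complexConj L) 1 (Matrix.of fun i j : Fin 1 => if i.val + j.val + 1 = 1 then (1 : L) else 0) w)) := by
      ext g
      simp only [SetLike.mem_coe, MonoidHom.mem_ker, Set.mem_preimage, MonoidHom.comp_apply, AdelicGroupData.AutomorphicCharacter.coe_toMonoidHom]
      rw [cmDetChar_inclPlaceAdelic, ContinuousMulEquiv.apply_symm_apply]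
    rw [hset]
    exact hopen.preimage (localPiEquiv L (IsCMField.complexConj L) 1 _ w).symm.continuous
  · -- `hΘ`: ★ `cmDetChar_inclPlaceAdelic`
    rw [MonoidHom.comp_apply, cmDetChar_inclPlaceAdelic]
    rfl
  · -- the pin at `v`
    show (torusLocalComponent L (IsCMField.complexConj L) v ψ').comp _ = _
    rw [hv, chiOneOfOneDim_eq_torusLocalComponent_comp_localDet]
    rfl
  · -- trivial on the integral level at `w ≠ v`
    rw [MonoidHom.comp_apply, torusLocalComponent_apply]
    exact hsph w hw _ (coe_locTorusIncl_localDet_mem_localUnitIdeles w k hk)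

/-! ## §3 L-C′ in the H1 layer, UNCONDITIONAL at non-split `v` (torus layer ★ `torusCharExtendLetter_holds`) -/

/-- **L-C′ DISCHARGED IN THE H1 LAYER: at a place `v` of `L⁺` NOT split in `L`, the `U(Φ₁)`-line of block C EXISTS** — an automorphic character `Θ` of `U(Φ₁)(𝔸_{L⁺})` with
smooth local readings `θloc w` (R4′ binders `Θ θloc hθo hΘ` of ★ `thetaLine_of_char`), PINNED at `v` to `ξ_v ∘ inr = ψ_v ∘ det` (★ `R90.S5.chiOneOfOneDim ξ v`) and TRIVIAL on
`U(Φ₁)(𝒪_w)` at every finite `w ≠ v` («`ρ = ρ′ ⊠ θ` … where `θ` is a character of `U(Φ₁)` such that `θ_v = χ`», unramified off `v`): the bridge `exists_thetaChar_of_torusCharExtendLetter`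
applied to the ★ torus layer `torusCharExtendLetter_holds L v` (K2E5-p16, p864932: Weil's extension principle on the anisotropic torus, obstruction `μ(L)` killed at one
complex place by ★ B3 `exists_archExponents_compensating`).  Consumer: `obtain ⟨Θ, θloc, hθo, hΘ, hθv, hθunr⟩ := exists_thetaChar_of_nonsplit ξ hns`.
[cite: Rogawski1990, §13.8 p. 217 l. 9–12, p. 218 L9–10, p. 219 L1–2; §13.3 pp. 202–203] [cite: Weil1956, §1] -/
theorem exists_thetaChar_of_nonsplit (ξ : OneDimAutRepH L) {v : Pl L} (hns : ∀ w : PlacesOver L v, IsCMField.complexConj L • w.1 = w.1) :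
    ∃ (Θ : (H1 L).AutomorphicCharacter) (θloc : ∀ w : Pl L, H1Loc L w →* ℂˣ),
      (∀ w : Pl L, IsOpen ((((θloc w).ker : Subgroup (H1Loc L w))) : Set (H1Loc L w))) ∧
      (∀ (w : Pl L) (u : localPi L (IsCMField.complexConj L) 1 (Matrix.of fun i j : Fin 1 => if i.val + j.val + 1 = 1 then (1 : L) else 0) w),
        θloc w (localPiEquiv L (IsCMField.complexConj L) 1 (Matrix.of fun i j : Fin 1 => if i.val + j.val + 1 = 1 then (1 : L) else 0) w u) =
          Θ (inclPlaceAdelic (↥(maximalRealSubfield L)) L (IsCMField.complexConj L) 1 (Matrix.of fun i j : Fin 1 => if i.val + j.val + 1 = 1 then (1 : L) else 0) w u)) ∧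
      θloc v = R90.S5.chiOneOfOneDim ξ v ∧
      ∀ w : Pl L, w ≠ v → ∀ k ∈ cmLocalIntegralLevel L 1 (Matrix.of fun i j : Fin 1 => if i.val + j.val + 1 = 1 then (1 : L) else 0) w, θloc w k = 1 :=
  exists_thetaChar_of_torusCharExtendLetter (torusCharExtendLetter_holds L v) ξ hns

end Summit.HodgeConjecture.HodgeConjecture.R90.S10

end
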